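import Summits.AtomisticToContinuum.FouriersLaw.Theorems.VanishingNoiseTransferNoiseLocalityFeketeReduction

/-!
# `NoiseLocality` (stmt-AtomisticToContinuum-11975) reduced further: (deterministic two-sided series law) ∧ (Matthiessen extensivity)

Importable record of skeleton v5 of line `fekete-transposed-uniformity` (lead `prover-line-stmt-AtomisticToContinuum-11975-c1-0`,
2026-08-17). The line's single N-uniform stub (uniform two-sided series law, `ε ∈ (0,1]`) is split into
* 4a `SeriesLawAtZero` — the DETERMINISTIC two-sided series law, which is exactly the conjunction of the open sibling cruxes
  stmt-14041 `FeketeSeriesLaw.QuasiSubadditiveResistance` ∧ stmt-11748 `JunctionLocality.SuperadditiveResistance`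
  (`seriesLawAtZero_of_siblings`), i.e. a dependency edge, and
* 4b `MatthiessenExtensivity` — `|Δ_{N,M}(ε) − Δ_{N,M}(0)| ≤ C` uniformly in `ε ∈ (0,1]` (the flip-added junction defect is
  extensive up to `O(1)`): the crux's own, genuinely new N-uniform content in resistance form.
`uniformSeriesLaw_of_zero_of_extensivity` (glue, proved from the landed stubs 1–3 at `ε = 0`) and
`noiseLocality_of_zero_of_extensivity : 4a-text → 4b-text → NoiseLocality ∧ 14041 ∧ 11748`. CONDITIONAL results; no definitions;
nothing here closes an item.
-/

noncomputable section

namespace Summit.AtomisticToContinuum.FouriersLaw.Theorems.NoiseLocality.FeketeReduction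

open Filter Topology MeasureTheory
open Literature.MathematicalPhysics.KineticTheory.HeatConduction

/-- **Glue of the v5 reshape (proved): stub 4a ∧ stub 4b ⟹ stub 4** with `C = C₀ + C′`, where `C₀` is 4a's constant for the
canonical deterministic family — built from the LANDED stubs 1–3 at `ε = 0` (existence/uniqueness, responses, positivity). [folklore] -/
theorem uniformSeriesLaw_of_zero_of_extensivity
    (h4a : ∀ ω₂ lam β γ : ℝ, 0 < ω₂ → 0 < lam → 0 < β → 0 < γ →
          (∀ (N : ℕ) (T_L T_R : ℝ), 0 < T_L → 0 < T_R →
            ∀ μ ν : MeasureTheory.Measure (Literature.MathematicalPhysics.KineticTheory.HeatConduction.PhaseSpace N),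
              (Literature.MathematicalPhysics.KineticTheory.HeatConduction.pinnedChain ω₂ lam β γ).IsSteadyState N T_L T_R μ →
              (Literature.MathematicalPhysics.KineticTheory.HeatConduction.pinnedChain ω₂ lam β γ).IsSteadyState N T_L T_R ν →
              μ = ν) →
          ∀ μ : (N : ℕ) → ℝ → ℝ →
              MeasureTheory.Measure (Literature.MathematicalPhysics.KineticTheory.HeatConduction.PhaseSpace N),
          (∀ (N : ℕ) (T_L T_R : ℝ), 0 < T_L → 0 < T_R →
            (Literature.MathematicalPhysics.KineticTheory.HeatConduction.pinnedChain ω₂ lam β γ).IsSteadyState N T_L T_R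
              (μ N T_L T_R)) →
          ∀ T : ℝ, 0 < T → ∀ D : ℕ → ℝ,
          (∀ N : ℕ, Filter.Tendsto (fun δ : ℝ =>
              (Literature.MathematicalPhysics.KineticTheory.HeatConduction.pinnedChain ω₂ lam β γ).totalCurrent
                (μ N (T + δ / 2) (T - δ / 2)) / δ) (nhdsWithin 0 {(0 : ℝ)}ᶜ) (nhds (D N))) →
          (∀ N : ℕ, 2 ≤ N → 0 < D N) →
          ∃ C : ℝ, ∀ N M : ℕ, 2 ≤ N → 2 ≤ M →
            |((N : ℝ) + (M : ℝ) - 1) / D (N + M) - ((N : ℝ) - 1) / D N - ((M : ℝ) - 1) / D M| ≤ C)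
    (h4b : ∀ ω₂ lam β γ : ℝ, 0 < ω₂ → 0 < lam → 0 < β → 0 < γ → ∀ T : ℝ, 0 < T →
          ∃ C : ℝ, ∀ ε : ℝ, 0 < ε → ε ≤ 1 →
          ∀ μ : (N : ℕ) → ℝ → ℝ →
              MeasureTheory.Measure (Literature.MathematicalPhysics.KineticTheory.HeatConduction.PhaseSpace N),
          (∀ (N : ℕ) (T_L T_R : ℝ), 0 < T_L → 0 < T_R →
            (Literature.MathematicalPhysics.KineticTheory.HeatConduction.pinnedChain ω₂ lam β γ).IsFlipSteadyState
                N T_L T_R ε (μ N T_L T_R) ∧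
              ∀ ν : MeasureTheory.Measure (Literature.MathematicalPhysics.KineticTheory.HeatConduction.PhaseSpace N),
                (Literature.MathematicalPhysics.KineticTheory.HeatConduction.pinnedChain ω₂ lam β γ).IsFlipSteadyState
                  N T_L T_R ε ν → ν = μ N T_L T_R) →
          ∀ D : ℕ → ℝ,
          (∀ N : ℕ, Filter.Tendsto (fun δ : ℝ =>
              (Literature.MathematicalPhysics.KineticTheory.HeatConduction.pinnedChain ω₂ lam β γ).totalCurrent
                (μ N (T + δ / 2) (T - δ / 2)) / δ) (nhdsWithin 0 {(0 : ℝ)}ᶜ) (nhds (D N))) →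
          (∀ N : ℕ, 2 ≤ N → 0 < D N) →
          ∀ μ0 : (N : ℕ) → ℝ → ℝ →
              MeasureTheory.Measure (Literature.MathematicalPhysics.KineticTheory.HeatConduction.PhaseSpace N),
          (∀ (N : ℕ) (T_L T_R : ℝ), 0 < T_L → 0 < T_R →
            (Literature.MathematicalPhysics.KineticTheory.HeatConduction.pinnedChain ω₂ lam β γ).IsSteadyState
                N T_L T_R (μ0 N T_L T_R) ∧
              ∀ ν : MeasureTheory.Measure (Literature.MathematicalPhysics.KineticTheory.HeatConduction.PhaseSpace N),
                (Literature.MathematicalPhysics.KineticTheory.HeatConduction.pinnedChain ω₂ lam β γ).IsSteadyState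
                  N T_L T_R ν → ν = μ0 N T_L T_R) →
          ∀ D0 : ℕ → ℝ,
          (∀ N : ℕ, Filter.Tendsto (fun δ : ℝ =>
              (Literature.MathematicalPhysics.KineticTheory.HeatConduction.pinnedChain ω₂ lam β γ).totalCurrent
                (μ0 N (T + δ / 2) (T - δ / 2)) / δ) (nhdsWithin 0 {(0 : ℝ)}ᶜ) (nhds (D0 N))) →
          (∀ N : ℕ, 2 ≤ N → 0 < D0 N) →
          ∀ N M : ℕ, 2 ≤ N → 2 ≤ M →
            |(((N : ℝ) + (M : ℝ) - 1) / D (N + M) - ((N : ℝ) - 1) / D N - ((M : ℝ) - 1) / D M) -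
              (((N : ℝ) + (M : ℝ) - 1) / D0 (N + M) - ((N : ℝ) - 1) / D0 N - ((M : ℝ) - 1) / D0 M)| ≤ C) :
    ∀ ω₂ lam β γ : ℝ, 0 < ω₂ → 0 < lam → 0 < β → 0 < γ → ∀ T : ℝ, 0 < T →
        ∃ C : ℝ, ∀ ε : ℝ, 0 < ε → ε ≤ 1 →
        ∀ μ : (N : ℕ) → ℝ → ℝ →
            MeasureTheory.Measure (Literature.MathematicalPhysics.KineticTheory.HeatConduction.PhaseSpace N),
        (∀ (N : ℕ) (T_L T_R : ℝ), 0 < T_L → 0 < T_R →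
          (Literature.MathematicalPhysics.KineticTheory.HeatConduction.pinnedChain ω₂ lam β γ).IsFlipSteadyState
              N T_L T_R ε (μ N T_L T_R) ∧
            ∀ ν : MeasureTheory.Measure (Literature.MathematicalPhysics.KineticTheory.HeatConduction.PhaseSpace N),
              (Literature.MathematicalPhysics.KineticTheory.HeatConduction.pinnedChain ω₂ lam β γ).IsFlipSteadyState
                N T_L T_R ε ν → ν = μ N T_L T_R) →
        ∀ D : ℕ → ℝ,
        (∀ N : ℕ, Filter.Tendsto (fun δ : ℝ =>
            (Literature.MathematicalPhysics.KineticTheory.HeatConduction.pinnedChain ω₂ lam β γ).totalCurrent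
              (μ N (T + δ / 2) (T - δ / 2)) / δ) (nhdsWithin 0 {(0 : ℝ)}ᶜ) (nhds (D N))) →
        (∀ N : ℕ, 2 ≤ N → 0 < D N) →
        ∀ N M : ℕ, 2 ≤ N → 2 ≤ M →
          |((N : ℝ) + (M : ℝ) - 1) / D (N + M) - ((N : ℝ) - 1) / D N - ((M : ℝ) - 1) / D M| ≤ C := by
  intro ω₂ lam β γ hω hl hβ hγ T hT
  set P := Literature.MathematicalPhysics.KineticTheory.HeatConduction.pinnedChain ω₂ lam β γ with hP
  -- (0) the canonical deterministic family from stub 1 at rate 0 (junk outside positive temperatures)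
  have hex : ∀ (N : ℕ) (T_L T_R : ℝ), ∃ μ : MeasureTheory.Measure
      (Literature.MathematicalPhysics.KineticTheory.HeatConduction.PhaseSpace N),
      (0 < T_L → 0 < T_R → P.IsSteadyState N T_L T_R μ ∧
        ∀ ν : MeasureTheory.Measure (Literature.MathematicalPhysics.KineticTheory.HeatConduction.PhaseSpace N),
          P.IsSteadyState N T_L T_R ν → ν = μ) := by
    intro N T_L T_R
    by_cases h : 0 < T_L ∧ 0 < T_R
    · obtain ⟨μ, hμ, huniq⟩ := Summit.AtomisticToContinuum.FouriersLaw.Theorems.NoiseLocality.stub_flipSteadyStateWellPosed ω₂ lam β γ hω hl hβ hγ N 0 le_rfl zero_le_one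
        T_L T_R h.1 h.2
      refine ⟨μ, fun _ _ => ⟨(P.isFlipSteadyState_zero_iff N T_L T_R μ).1 hμ, fun ν hν => ?_⟩⟩
      exact huniq ν ((P.isFlipSteadyState_zero_iff N T_L T_R ν).2 hν)
    · exact ⟨0, fun hL hR => (h ⟨hL, hR⟩).elim⟩
  choose μ0 hμ0 using hex
  have hfam0 : ∀ (N : ℕ) (T_L T_R : ℝ), 0 < T_L → 0 < T_R → P.IsSteadyState N T_L T_R (μ0 N T_L T_R) :=
    fun N T_L T_R hL hR => (hμ0 N T_L T_R hL hR).1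
  have huniq0 : ∀ (N : ℕ) (T_L T_R : ℝ), 0 < T_L → 0 < T_R →
      ∀ μ ν : MeasureTheory.Measure (Literature.MathematicalPhysics.KineticTheory.HeatConduction.PhaseSpace N),
        P.IsSteadyState N T_L T_R μ → P.IsSteadyState N T_L T_R ν → μ = ν := by
    intro N T_L T_R hL hR μ ν hμ hν
    rw [(hμ0 N T_L T_R hL hR).2 μ hμ, (hμ0 N T_L T_R hL hR).2 ν hν]
  have hfam0' : ∀ (N : ℕ) (T_L T_R : ℝ), 0 < T_L → 0 < T_R →
      P.IsSteadyState N T_L T_R (μ0 N T_L T_R) ∧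
        ∀ ν : MeasureTheory.Measure (Literature.MathematicalPhysics.KineticTheory.HeatConduction.PhaseSpace N),
          P.IsSteadyState N T_L T_R ν → ν = μ0 N T_L T_R :=
    fun N T_L T_R hL hR => hμ0 N T_L T_R hL hR
  have hfamFlip0 : ∀ (N : ℕ) (T_L T_R : ℝ), 0 < T_L → 0 < T_R →
      P.IsFlipSteadyState N T_L T_R 0 (μ0 N T_L T_R) ∧
        ∀ ν : MeasureTheory.Measure (Literature.MathematicalPhysics.KineticTheory.HeatConduction.PhaseSpace N),
          P.IsFlipSteadyState N T_L T_R 0 ν → ν = μ0 N T_L T_R := by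
    intro N T_L T_R hL hR
    refine ⟨(P.isFlipSteadyState_zero_iff N T_L T_R _).2 (hfam0 N T_L T_R hL hR), fun ν hν => ?_⟩
    exact (hμ0 N T_L T_R hL hR).2 ν ((P.isFlipSteadyState_zero_iff N T_L T_R ν).1 hν)
  -- (1) its responses at `T` from stub 2 at rate 0, positive for `N ≥ 2` by stub 3
  choose Dfun _hDcont hDfun using fun N : ℕ => Summit.AtomisticToContinuum.FouriersLaw.Theorems.NoiseLocality.stub_responseContinuousInNoise ω₂ lam β γ hω hl hβ hγ N T hT
  have hD0 : ∀ N : ℕ, Filter.Tendsto (fun δ : ℝ => P.totalCurrent (μ0 N (T + δ / 2) (T - δ / 2)) / δ)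
      (nhdsWithin 0 {(0 : ℝ)}ᶜ) (nhds (Dfun N 0)) :=
    fun N => hDfun N 0 le_rfl zero_le_one (μ0 N) (hfamFlip0 N)
  have hpos0 : ∀ N : ℕ, 2 ≤ N → 0 < Dfun N 0 :=
    fun N hN => Summit.AtomisticToContinuum.FouriersLaw.Theorems.NoiseLocality.stub_positiveNoisyConductance ω₂ lam β γ hω hl hβ hγ N hN 0 le_rfl zero_le_one T hT (μ0 N)
      (hfamFlip0 N) (Dfun N 0) (hD0 N)
  -- (2) the two constants
  obtain ⟨C₀, hC₀⟩ := h4a ω₂ lam β γ hω hl hβ hγ huniq0 μ0 hfam0 T hT (fun N => Dfun N 0) hD0 hpos0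
  obtain ⟨C', hC'⟩ := h4b ω₂ lam β γ hω hl hβ hγ T hT
  refine ⟨C₀ + C', fun ε hε hε1 μ hμ D hD hpos N M hN hM => ?_⟩
  have h1 := hC' ε hε hε1 μ hμ D hD hpos μ0 hfam0' (fun N => Dfun N 0) hD0 hpos0 N M hN hM
  have h2 := hC₀ N M hN hM
  have htri := abs_sub_abs_le_abs_sub
    (((N : ℝ) + (M : ℝ) - 1) / D (N + M) - ((N : ℝ) - 1) / D N - ((M : ℝ) - 1) / D M)
    (((N : ℝ) + (M : ℝ) - 1) / Dfun (N + M) 0 - ((N : ℝ) - 1) / Dfun N 0 - ((M : ℝ) - 1) / Dfun M 0)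
  linarith


/-- **Stub 4a ⇐ the two sibling cruxes** (gen-1's `seriesLawAtZero_of_siblings`, re-proved): 14041 (upper law, resistances with
`ℕ`-subtraction casts) ∧ 11748 (lower law) give the deterministic two-sided law with `C = max C₁ C₂`. The dependency edge that makes
stub 4a "blocked on 14041 ∧ 11748" precise. [folklore] -/
theorem seriesLawAtZero_of_siblings
    (hsub : Summit.AtomisticToContinuum.FouriersLaw.Theses.FeketeSeriesLaw.QuasiSubadditiveResistance)
    (hsup : Summit.AtomisticToContinuum.FouriersLaw.Theses.JunctionLocality.SuperadditiveResistance) :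
    ∀ ω₂ lam β γ : ℝ, 0 < ω₂ → 0 < lam → 0 < β → 0 < γ →
        (∀ (N : ℕ) (T_L T_R : ℝ), 0 < T_L → 0 < T_R →
          ∀ μ ν : MeasureTheory.Measure (Literature.MathematicalPhysics.KineticTheory.HeatConduction.PhaseSpace N),
            (Literature.MathematicalPhysics.KineticTheory.HeatConduction.pinnedChain ω₂ lam β γ).IsSteadyState N T_L T_R μ →
            (Literature.MathematicalPhysics.KineticTheory.HeatConduction.pinnedChain ω₂ lam β γ).IsSteadyState N T_L T_R ν →
            μ = ν) →
        ∀ μ : (N : ℕ) → ℝ → ℝ →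
            MeasureTheory.Measure (Literature.MathematicalPhysics.KineticTheory.HeatConduction.PhaseSpace N),
        (∀ (N : ℕ) (T_L T_R : ℝ), 0 < T_L → 0 < T_R →
          (Literature.MathematicalPhysics.KineticTheory.HeatConduction.pinnedChain ω₂ lam β γ).IsSteadyState N T_L T_R
            (μ N T_L T_R)) →
        ∀ T : ℝ, 0 < T → ∀ D : ℕ → ℝ,
        (∀ N : ℕ, Filter.Tendsto (fun δ : ℝ =>
            (Literature.MathematicalPhysics.KineticTheory.HeatConduction.pinnedChain ω₂ lam β γ).totalCurrent
              (μ N (T + δ / 2) (T - δ / 2)) / δ) (nhdsWithin 0 {(0 : ℝ)}ᶜ) (nhds (D N))) →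
        (∀ N : ℕ, 2 ≤ N → 0 < D N) →
        ∃ C : ℝ, ∀ N M : ℕ, 2 ≤ N → 2 ≤ M →
          |((N : ℝ) + (M : ℝ) - 1) / D (N + M) - ((N : ℝ) - 1) / D N - ((M : ℝ) - 1) / D M| ≤ C := by
  intro ω₂ lam β γ hω hl hβ hγ huniq μ hμ T hT D hD hpos
  obtain ⟨C₁, h₁⟩ := hsub ω₂ lam β γ hω hl hβ hγ huniq μ hμ T hT D hD
  obtain ⟨C₂, h₂⟩ := hsup ω₂ lam β γ hω hl hβ hγ huniq μ hμ T hT D hD hpos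
  refine ⟨max C₁ C₂, fun N M hN hM => ?_⟩
  have e1 : ((N - 1 : ℕ) : ℝ) = (N : ℝ) - 1 := by
    rw [Nat.cast_sub (by omega : 1 ≤ N), Nat.cast_one]
  have e2 : ((M - 1 : ℕ) : ℝ) = (M : ℝ) - 1 := by
    rw [Nat.cast_sub (by omega : 1 ≤ M), Nat.cast_one]
  have e3 : ((N + M - 1 : ℕ) : ℝ) = (N : ℝ) + (M : ℝ) - 1 := by
    rw [Nat.cast_sub (by omega : 1 ≤ N + M), Nat.cast_add, Nat.cast_one]
  have hup := h₁ N M hN hM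
  rw [e1, e2, e3] at hup
  have hlo := h₂ N M hN hM
  have hm1 := le_max_left C₁ C₂
  have hm2 := le_max_right C₁ C₂
  rw [abs_le]
  constructor <;> linarith


/-- **NoiseLocality ⇐ (deterministic two-sided series law) ∧ (Matthiessen extensivity)**, together with both sibling cruxes:
the glue `uniformSeriesLaw_of_zero_of_extensivity` fed into `noiseLocality_of_uniformSeriesLaw` / `siblings_of_uniformSeriesLaw`.
CONDITIONAL on the two registered stub texts (hypotheses). [folklore] -/
theorem noiseLocality_of_zero_of_extensivity
    (h4a : ∀ ω₂ lam β γ : ℝ, 0 < ω₂ → 0 < lam → 0 < β → 0 < γ →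
          (∀ (N : ℕ) (T_L T_R : ℝ), 0 < T_L → 0 < T_R →
            ∀ μ ν : MeasureTheory.Measure (Literature.MathematicalPhysics.KineticTheory.HeatConduction.PhaseSpace N),
              (Literature.MathematicalPhysics.KineticTheory.HeatConduction.pinnedChain ω₂ lam β γ).IsSteadyState N T_L T_R μ →
              (Literature.MathematicalPhysics.KineticTheory.HeatConduction.pinnedChain ω₂ lam β γ).IsSteadyState N T_L T_R ν →
              μ = ν) →
          ∀ μ : (N : ℕ) → ℝ → ℝ →
              MeasureTheory.Measure (Literature.MathematicalPhysics.KineticTheory.HeatConduction.PhaseSpace N),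
          (∀ (N : ℕ) (T_L T_R : ℝ), 0 < T_L → 0 < T_R →
            (Literature.MathematicalPhysics.KineticTheory.HeatConduction.pinnedChain ω₂ lam β γ).IsSteadyState N T_L T_R
              (μ N T_L T_R)) →
          ∀ T : ℝ, 0 < T → ∀ D : ℕ → ℝ,
          (∀ N : ℕ, Filter.Tendsto (fun δ : ℝ =>
              (Literature.MathematicalPhysics.KineticTheory.HeatConduction.pinnedChain ω₂ lam β γ).totalCurrent
                (μ N (T + δ / 2) (T - δ / 2)) / δ) (nhdsWithin 0 {(0 : ℝ)}ᶜ) (nhds (D N))) →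
          (∀ N : ℕ, 2 ≤ N → 0 < D N) →
          ∃ C : ℝ, ∀ N M : ℕ, 2 ≤ N → 2 ≤ M →
            |((N : ℝ) + (M : ℝ) - 1) / D (N + M) - ((N : ℝ) - 1) / D N - ((M : ℝ) - 1) / D M| ≤ C)
    (h4b : ∀ ω₂ lam β γ : ℝ, 0 < ω₂ → 0 < lam → 0 < β → 0 < γ → ∀ T : ℝ, 0 < T →
          ∃ C : ℝ, ∀ ε : ℝ, 0 < ε → ε ≤ 1 →
          ∀ μ : (N : ℕ) → ℝ → ℝ →
              MeasureTheory.Measure (Literature.MathematicalPhysics.KineticTheory.HeatConduction.PhaseSpace N),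
          (∀ (N : ℕ) (T_L T_R : ℝ), 0 < T_L → 0 < T_R →
            (Literature.MathematicalPhysics.KineticTheory.HeatConduction.pinnedChain ω₂ lam β γ).IsFlipSteadyState
                N T_L T_R ε (μ N T_L T_R) ∧
              ∀ ν : MeasureTheory.Measure (Literature.MathematicalPhysics.KineticTheory.HeatConduction.PhaseSpace N),
                (Literature.MathematicalPhysics.KineticTheory.HeatConduction.pinnedChain ω₂ lam β γ).IsFlipSteadyState
                  N T_L T_R ε ν → ν = μ N T_L T_R) →
          ∀ D : ℕ → ℝ,
          (∀ N : ℕ, Filter.Tendsto (fun δ : ℝ =>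
              (Literature.MathematicalPhysics.KineticTheory.HeatConduction.pinnedChain ω₂ lam β γ).totalCurrent
                (μ N (T + δ / 2) (T - δ / 2)) / δ) (nhdsWithin 0 {(0 : ℝ)}ᶜ) (nhds (D N))) →
          (∀ N : ℕ, 2 ≤ N → 0 < D N) →
          ∀ μ0 : (N : ℕ) → ℝ → ℝ →
              MeasureTheory.Measure (Literature.MathematicalPhysics.KineticTheory.HeatConduction.PhaseSpace N),
          (∀ (N : ℕ) (T_L T_R : ℝ), 0 < T_L → 0 < T_R →
            (Literature.MathematicalPhysics.KineticTheory.HeatConduction.pinnedChain ω₂ lam β γ).IsSteadyState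
                N T_L T_R (μ0 N T_L T_R) ∧
              ∀ ν : MeasureTheory.Measure (Literature.MathematicalPhysics.KineticTheory.HeatConduction.PhaseSpace N),
                (Literature.MathematicalPhysics.KineticTheory.HeatConduction.pinnedChain ω₂ lam β γ).IsSteadyState
                  N T_L T_R ν → ν = μ0 N T_L T_R) →
          ∀ D0 : ℕ → ℝ,
          (∀ N : ℕ, Filter.Tendsto (fun δ : ℝ =>
              (Literature.MathematicalPhysics.KineticTheory.HeatConduction.pinnedChain ω₂ lam β γ).totalCurrent
                (μ0 N (T + δ / 2) (T - δ / 2)) / δ) (nhdsWithin 0 {(0 : ℝ)}ᶜ) (nhds (D0 N))) →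
          (∀ N : ℕ, 2 ≤ N → 0 < D0 N) →
          ∀ N M : ℕ, 2 ≤ N → 2 ≤ M →
            |(((N : ℝ) + (M : ℝ) - 1) / D (N + M) - ((N : ℝ) - 1) / D N - ((M : ℝ) - 1) / D M) -
              (((N : ℝ) + (M : ℝ) - 1) / D0 (N + M) - ((N : ℝ) - 1) / D0 N - ((M : ℝ) - 1) / D0 M)| ≤ C) :
    Summit.AtomisticToContinuum.FouriersLaw.Theses.VanishingNoiseTransfer.NoiseLocality ∧
      Summit.AtomisticToContinuum.FouriersLaw.Theses.FeketeSeriesLaw.QuasiSubadditiveResistance ∧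
      Summit.AtomisticToContinuum.FouriersLaw.Theses.JunctionLocality.SuperadditiveResistance :=
  ⟨noiseLocality_of_uniformSeriesLaw (uniformSeriesLaw_of_zero_of_extensivity h4a h4b),
    siblings_of_uniformSeriesLaw (uniformSeriesLaw_of_zero_of_extensivity h4a h4b)⟩

/-- Registered helper sub-goal `helper_noiseLocalityOfZeroOfExtensivity` of crux stmt-AtomisticToContinuum-11975 =
`noiseLocality_of_zero_of_extensivity` in registry form (skeleton v5 of line `fekete-transposed-uniformity`). CONDITIONAL. [folklore] -/
theorem helper_noiseLocalityOfZeroOfExtensivity : (∀ ω₂ lam β γ : ℝ, 0 < ω₂ → 0 < lam → 0 < β → 0 < γ → (∀ (N : ℕ) (T_L T_R : ℝ), 0 < T_L → 0 < T_R → ∀ μ ν : MeasureTheory.Measure (Literature.MathematicalPhysics.KineticTheory.HeatConduction.PhaseSpace N), (Literature.MathematicalPhysics.KineticTheory.HeatConduction.pinnedChain ω₂ lam β γ).IsSteadyState N T_L T_R μ → (Literature.MathematicalPhysics.KineticTheory.HeatConduction.pinnedChain ω₂ lam β γ).IsSteadyState N T_L T_R ν → μ = ν) → ∀ μ : (N :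 ℕ) → ℝ → ℝ → MeasureTheory.Measure (Literature.MathematicalPhysics.KineticTheory.HeatConduction.PhaseSpace N), (∀ (N : ℕ) (T_L T_R : ℝ), 0 < T_L → 0 < T_R → (Literature.MathematicalPhysics.KineticTheory.HeatConduction.pinnedChain ω₂ lam β γ).IsSteadyState N T_L T_R (μ N T_L T_R)) → ∀ T : ℝ, 0 < T → ∀ D : ℕ → ℝ, (∀ N : ℕ, Filter.Tendsto (fun δ : ℝ => (Literature.MathematicalPhysics.KineticTheory.HeatConduction.pinnedChain ω₂ lam β γ).totalCurrent (μ N (T + δ / 2) (T - δ / 2)) / δ) (nhdsWithin 0 {(0 : ℝ)}ᶜ) (nhds (D N))) → (∀ N : ℕ, 2 ≤ N → 0 < D N) → ∃ C : ℝ, ∀ N M : ℕ, 2 ≤ N → 2 ≤ M → |((N : ℝ) + (M : ℝ) - 1) / D (N + M) - ((N : ℝ) - 1) / D N - ((M : ℝ) - 1) / D M| ≤ C) → (∀ ω₂ lam β γ : ℝ, 0 < ω₂ → 0 < lam → 0 < β → 0 < γ → ∀ T : ℝ, 0 < T → ∃ C : ℝ, ∀ ε : ℝ, 0 < ε → ε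 ≤ 1 → ∀ μ : (N : ℕ) → ℝ → ℝ → MeasureTheory.Measure (Literature.MathematicalPhysics.KineticTheory.HeatConduction.PhaseSpace N), (∀ (N : ℕ) (T_L T_R : ℝ), 0 < T_L → 0 < T_R → (Literature.MathematicalPhysics.KineticTheory.HeatConduction.pinnedChain ω₂ lam β γ).IsFlipSteadyState N T_L T_R ε (μ N T_L T_R) ∧ ∀ ν : MeasureTheory.Measure (Literature.MathematicalPhysics.KineticTheory.HeatConduction.PhaseSpace N), (Literature.MathematicalPhysics.KineticTheory.HeatConduction.pinnedChain ω₂ lam β γ).IsFlipSteadyState N T_L T_R ε ν → ν = μ N T_L T_R) → ∀ D : ℕ → ℝ, (∀ N : ℕ, Filter.Tendsto (fun δ : ℝ => (Literature.MathematicalPhysics.KineticTheory.HeatConduction.pinnedChain ω₂ lam β γ).totalCurrent (μ N (T + δ / 2) (T - δ / 2)) / δ) (nhdsWithin 0 {(0 : ℝ)}ᶜ) (nhds (D N))) → (∀ N : ℕ, 2 ≤ N → 0 < D N) → ∀ μ0 : (N : ℕ) → ℝ → ℝ → MeasureTheory.Measure (Literature.MathematicalPhysics.KineticTheory.HeatConduction.PhaseSpace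 N), (∀ (N : ℕ) (T_L T_R : ℝ), 0 < T_L → 0 < T_R → (Literature.MathematicalPhysics.KineticTheory.HeatConduction.pinnedChain ω₂ lam β γ).IsSteadyState N T_L T_R (μ0 N T_L T_R) ∧ ∀ ν : MeasureTheory.Measure (Literature.MathematicalPhysics.KineticTheory.HeatConduction.PhaseSpace N), (Literature.MathematicalPhysics.KineticTheory.HeatConduction.pinnedChain ω₂ lam β γ).IsSteadyState N T_L T_R ν → ν = μ0 N T_L T_R) → ∀ D0 : ℕ → ℝ, (∀ N : ℕ, Filter.Tendsto (fun δ : ℝ => (Literature.MathematicalPhysics.KineticTheory.HeatConduction.pinnedChain ω₂ lam β γ).totalCurrent (μ0 N (T + δ / 2) (T - δ / 2)) / δ) (nhdsWithin 0 {(0 : ℝ)}ᶜ) (nhds (D0 N))) → (∀ N : ℕ, 2 ≤ N → 0 < D0 N) → ∀ N M : ℕ, 2 ≤ N → 2 ≤ M → |(((N : ℝ) + (M : ℝ) - 1) / D (N + M) - ((N : ℝ) - 1) / D N - ((M : ℝ) - 1) / D M) - (((N : ℝ) + (M : ℝ) - 1) / D0 (N + M) - ((N : ℝ) - 1) / D0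 N - ((M : ℝ) - 1) / D0 M)| ≤ C) → Summit.AtomisticToContinuum.FouriersLaw.Theses.VanishingNoiseTransfer.NoiseLocality ∧ Summit.AtomisticToContinuum.FouriersLaw.Theses.FeketeSeriesLaw.QuasiSubadditiveResistance ∧ Summit.AtomisticToContinuum.FouriersLaw.Theses.JunctionLocality.SuperadditiveResistance :=
  fun h4a h4b => noiseLocality_of_zero_of_extensivity h4a h4b

end Summit.AtomisticToContinuum.FouriersLaw.Theorems.NoiseLocality.FeketeReduction

end
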